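import Mathlib
import HarnessLib
import Summits.ValiantsHypothesis.ValiantsHypothesis.Theorems.LacunarySymmetroidMatrixDescartesProductPlusOneFewPullers

/-!
# ValiantsHypothesis / LacunarySymmetroid — crux `MatrixDescartes` (stmt-ValiantsHypothesis-18050, V1),
# LINE (A) «product_plus_one», floor `OneChangeFloorK3`: the FEW-PULLERS WINDOW LAW and the LATE COUNT (every support ratio)

Consequences of ✓ `…ProductPlusOneFewPullers` (`psi_deriv_neg_at_zero_of_fewPullers`: in a pure incoherent company, at a zero of `Ψ` with
`(q−p)·#pullers ≤ p·m` the derivative is negative) via ✓ `no_two_zeros_of_deriv_neg_at_zeros` and ✓ `roots_filter_le_of_windowLaw`: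

* ★★ `X_mul_derivative_no_two_zeros_of_fewPullers`, `euler_window_roots_le_one_of_fewPullers` — pure INCOHERENT company (`a_{j0}a_{j1} < 0`,
  `a_{j0}a_{j2} < 0`), `K = 3`, bottom coupling, ANY support `d 0 < d 1 < d 2`: on a zero-free window `[u,v] ⊂ (0,∞)` on which at every point
  `(d₂−d₁)·#{unswitched rows} ≤ (d₁−d₀)·m`, `eulerNumerator d a 0` has AT MOST ONE root — risers of ANY age allowed (first law inside the
  «risers against pullers» core);
* `unswitched_of_le` — the unswitched set of an incoherent company only shrinks as `x` grows;
* ★★ `euler_roots_late_le_of_fewPullers` — if at `U₀ > 0` already `(d₂−d₁)·#{unswitched rows} ≤ (d₁−d₀)·m`, then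
  `#{roots of eulerNumerator d a 0 in [U₀,∞)} ≤ 2m + 1`: the last `⌊m(d₁−d₀)/(d₂−d₁)⌋` gaps of a pure incoherent company are tame at every ratio.

HONEST FRAMING: a cell of the research floor; NOT `OneChangeFloorK3` / the stubs / `MatrixDescartes`; `VP ≠ VNP` is NOT proved.
No definitions, no named facts; Mathlib + the lane files.
-/

set_option linter.dupNamespace false

namespace Summit.ValiantsHypothesis.ValiantsHypothesis.Theorems.LacunarySymmetroidMatrixDescartes

namespace ProductPlusOne

open Polynomial Finset
open scoped BigOperators

/-! ### §1 The window law in the normalised chart -/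

/-- ★★ **FEW-PULLERS WINDOW LAW (normalised chart).**  Pure incoherent company, `m ≥ 1`; on `[w₁,w₂] ⊂ (0,∞)` no row vanishes and at every
point `(k+1)·#{j : a_j g_j > 0} ≤ (e+1)·m`.  Then `X·P′` has no two zeros `w₁, w₂`. [this file's theorem] -/
theorem X_mul_derivative_no_two_zeros_of_fewPullers {m : ℕ} (hm : 0 < m) (a b c : Fin m → ℝ) (e k : ℕ) {w₁ w₂ : ℝ}
    (hw₁ : 0 < w₁) (hw : w₁ < w₂)
    (hinc : ∀ j, a j * b j < 0 ∧ a j * c j < 0)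
    (hfree : ∀ t ∈ Set.Icc w₁ w₂, ∀ j, a j + b j * t ^ (e + 1) + c j * t ^ (e + k + 2) ≠ 0)
    (hfew : ∀ t ∈ Set.Icc w₁ w₂, ((k : ℝ) + 1)
      * ((Finset.univ.filter (fun j => 0 < a j * (a j + b j * t ^ (e + 1) + c j * t ^ (e + k + 2)))).card : ℝ) ≤ ((e : ℝ) + 1) * m)
    (h1 : eval w₁ (X * derivative (∏ j, (C (a j) + C (b j) * X ^ (e + 1) + C (c j) * X ^ (e + k + 2)))) = 0)
    (h2 : eval w₂ (X * derivative (∏ j, (C (a j) + C (b j) * X ^ (e + 1) + C (c j) * X ^ (e + k + 2)))) = 0) : False := by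
  set φ : ℝ → ℝ := fun y => ∑ j, ((e + 1 : ℝ) * b j + (e + k + 2 : ℝ) * c j * y ^ (k + 1))
      / (a j + b j * y ^ (e + 1) + c j * y ^ (e + k + 2)) with hφ
  set φ' : ℝ → ℝ := fun t => ∑ j, ((((e + k + 2 : ℝ) * c j * ((k + 1 : ℝ) * t ^ k)) * (a j + b j * t ^ (e + 1) + c j * t ^ (e + k + 2))
        - ((e + 1 : ℝ) * b j + (e + k + 2 : ℝ) * c j * t ^ (k + 1))
          * (b j * ((e + 1 : ℝ) * t ^ e) + c j * ((e + k + 2 : ℝ) * t ^ (e + k + 1))))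
        / (a j + b j * t ^ (e + 1) + c j * t ^ (e + k + 2)) ^ 2) with hφ'
  have hder : ∀ t ∈ Set.Icc w₁ w₂, HasDerivAt φ (φ' t) t := by
    intro t ht
    have := HasDerivAt.fun_sum (u := Finset.univ) (fun j _ => hasDerivAt_term (a j) (b j) (c j) e k (hfree t ht j))
    rw [hφ]
    exact this
  have hdown : ∀ t ∈ Set.Icc w₁ w₂, φ t = 0 → φ' t < 0 := by
    intro t ht h0
    exact psi_deriv_neg_at_zero_of_fewPullers hm a b c e k (hw₁.trans_le ht.1) (hfree t ht) hinc (hfew t ht) h0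
  have h01 : φ w₁ = 0 := psi_eq_zero_of_eval_X_mul_derivative a b c e k hw₁ (hfree w₁ ⟨le_rfl, hw.le⟩) h1
  have h02 : φ w₂ = 0 := psi_eq_zero_of_eval_X_mul_derivative a b c e k (hw₁.trans hw) (hfree w₂ ⟨hw.le, le_rfl⟩) h2
  exact no_two_zeros_of_deriv_neg_at_zeros hder hdown le_rfl hw le_rfl h01 h02

/-! ### §2 The window law in the line's currency -/

/-- ★★ **FEW-PULLERS WINDOW LAW** (`K = 3`, bottom coupling, ANY support `d 0 < d 1 < d 2`, any `m`): a pure incoherent company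
(`a_{j0}a_{j1} < 0`, `a_{j0}a_{j2} < 0`), a zero-free window `[u,v] ⊂ (0,∞)` on which at every point
`(d₂−d₁)·#{j : a_{j0}·f_j(t) > 0} ≤ (d₁−d₀)·m` (few unswitched rows) ⇒ `eulerNumerator d a 0` (unfolded) has AT MOST ONE root in `[u,v]`.
[this file's theorem] -/
theorem euler_window_roots_le_one_of_fewPullers {m : ℕ} (d : Fin 3 → ℕ) (h01 : d 0 < d 1) (h12 : d 1 < d 2)
    (a : Fin m → Fin 3 → ℝ) (hinc : ∀ j, a j 0 * a j 1 < 0 ∧ a j 0 * a j 2 < 0) {u v : ℝ} (hu : 0 < u)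
    (hfree : ∀ t ∈ Set.Icc u v, ∀ j, (∑ l, C (a j l) * X ^ (d l) : ℝ[X]).eval t ≠ 0)
    (hfew : ∀ t ∈ Set.Icc u v, ((d 2 : ℝ) - d 1)
      * ((Finset.univ.filter (fun j => 0 < a j 0 * (∑ l, C (a j l) * X ^ (d l) : ℝ[X]).eval t)).card : ℝ)
        ≤ ((d 1 : ℝ) - d 0) * m) :
    ((∑ j, (∑ l, C (a j l * ((d l : ℝ) - d 0)) * X ^ (d l)) * ∏ i ∈ Finset.univ.erase j, (∑ l, C (a i l) * X ^ (d l))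
        : ℝ[X]).roots.toFinset.filter (fun t => u ≤ t ∧ t ≤ v)).card ≤ 1 := by
  classical
  rcases Nat.eq_zero_or_pos m with hm | hm
  · subst hm
    simp only [Finset.univ_eq_empty, Finset.sum_empty, roots_zero, Multiset.toFinset_zero, Finset.filter_empty,
      Finset.card_empty]
    exact Nat.zero_le _
  obtain ⟨e, he⟩ : ∃ e, d 1 = d 0 + e + 1 := ⟨d 1 - d 0 - 1, by omega⟩
  obtain ⟨k, hk⟩ : ∃ k, d 2 = d 0 + e + k + 2 := ⟨d 2 - d 1 - 1, by omega⟩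
  have hp : ((d 1 : ℝ) - d 0) = (e + 1 : ℝ) := by rw [he]; push_cast; ring
  have hqp : ((d 2 : ℝ) - d 1) = (k + 1 : ℝ) := by rw [hk, he]; push_cast; ring
  rw [eulerNumerator_eq d e k he hk a 0, sub_self, mul_zero, map_zero, zero_mul, sub_zero]
  set E : ℝ[X] := X * derivative (∏ j, (C (a j 0) + C (a j 1) * X ^ (e + 1) + C (a j 2) * X ^ (e + k + 2))) with hE
  by_contra hgt
  push Not at hgt
  obtain ⟨z₁, hz₁, z₂, hz₂, hne⟩ := Finset.one_lt_card.mp hgt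
  have hfree' : ∀ w₁ w₂ : ℝ, u ≤ w₁ → w₂ ≤ v → ∀ t ∈ Set.Icc w₁ w₂, ∀ j,
      a j 0 + a j 1 * t ^ (e + 1) + a j 2 * t ^ (e + k + 2) ≠ 0 := by
    intro w₁ w₂ hw₁ hw₂ t ht j
    have h := hfree t ⟨hw₁.trans ht.1, ht.2.trans hw₂⟩ j
    rw [eval_row_eq_pow_mul d e k he hk (a j) t] at h
    exact right_ne_zero_of_mul h
  have hfew' : ∀ w₁ w₂ : ℝ, u ≤ w₁ → w₂ ≤ v → ∀ t ∈ Set.Icc w₁ w₂, ((k : ℝ) + 1)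
      * ((Finset.univ.filter (fun j => 0 < a j 0 * (a j 0 + a j 1 * t ^ (e + 1) + a j 2 * t ^ (e + k + 2)))).card : ℝ)
        ≤ ((e : ℝ) + 1) * m := by
    intro w₁ w₂ hw₁ hw₂ t ht
    have htI : t ∈ Set.Icc u v := ⟨hw₁.trans ht.1, ht.2.trans hw₂⟩
    have ht0 : 0 < t := hu.trans_le htI.1
    have h := hfew t htI
    rw [hp, hqp] at h
    have hset : Finset.univ.filter (fun j => 0 < a j 0 * (∑ l, C (a j l) * X ^ (d l) : ℝ[X]).eval t)
        = Finset.univ.filter (fun j => 0 < a j 0 * (a j 0 + a j 1 * t ^ (e + 1) + a j 2 * t ^ (e + k + 2))) := by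
      refine Finset.filter_congr (fun j _ => ?_)
      rw [eval_row_eq_pow_mul d e k he hk (a j) t, mul_left_comm]
      exact ⟨fun h' => pos_of_mul_pos_right h' (pow_pos ht0 _).le, fun h' => mul_pos (pow_pos ht0 _) h'⟩
    rw [hset] at h
    convert h using 2
  have hmem : ∀ z ∈ (((X : ℝ[X]) ^ (m * d 0) * E).roots.toFinset.filter (fun t => u ≤ t ∧ t ≤ v)),
      u ≤ z ∧ z ≤ v ∧ eval z E = 0 := by
    intro z hz
    rw [mem_filter, Multiset.mem_toFinset] at hz
    by_cases h0 : (X : ℝ[X]) ^ (m * d 0) * E = 0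
    · rw [h0, roots_zero] at hz
      exact absurd hz.1 (Multiset.notMem_zero _)
    · have hr := (mem_roots h0).mp hz.1
      rw [IsRoot.def, eval_mul, eval_pow, eval_X] at hr
      refine ⟨hz.2.1, hz.2.2, ?_⟩
      rcases mul_eq_zero.mp hr with h | h
      · exact absurd h (pow_ne_zero _ (hu.trans_le hz.2.1).ne')
      · exact h
  have hinc' : ∀ j, a j 0 * a j 1 < 0 ∧ a j 0 * a j 2 < 0 := hinc
  obtain ⟨hu₁, hv₁, hE₁⟩ := hmem z₁ hz₁
  obtain ⟨hu₂, hv₂, hE₂⟩ := hmem z₂ hz₂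
  rcases lt_or_gt_of_ne hne with hlt | hlt
  · exact X_mul_derivative_no_two_zeros_of_fewPullers hm (fun j => a j 0) (fun j => a j 1) (fun j => a j 2) e k
      (hu.trans_le hu₁) hlt hinc' (hfree' z₁ z₂ hu₁ hv₂) (hfew' z₁ z₂ hu₁ hv₂) hE₁ hE₂
  · exact X_mul_derivative_no_two_zeros_of_fewPullers hm (fun j => a j 0) (fun j => a j 1) (fun j => a j 2) e k
      (hu.trans_le hu₂) hlt hinc' (hfree' z₂ z₁ hu₂ hv₁) (hfew' z₂ z₁ hu₂ hv₁) hE₂ hE₁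

/-! ### §3 The late count -/

/-- **The unswitched set only shrinks:** for an incoherent no-dip row (`a b < 0`, `a c < 0`), `a·g(t) = a² + ab·t^p + ac·t^q` is decreasing in
`t > 0`; so unswitched at `t` implies unswitched at every `s ≤ t`. [folklore] -/
theorem unswitched_of_le (a b c : ℝ) (e k : ℕ) (hab : a * b < 0) (hac : a * c < 0) {s t : ℝ} (hs : 0 < s) (hst : s ≤ t)
    (ht : 0 < a * (a + b * t ^ (e + 1) + c * t ^ (e + k + 2))) : 0 < a * (a + b * s ^ (e + 1) + c * s ^ (e + k + 2)) := by
  have h1 : a * b * t ^ (e + 1) ≤ a * b * s ^ (e + 1) := mul_le_mul_of_nonpos_left (pow_le_pow_left₀ hs.le hst _) hab.le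
  have h2 : a * c * t ^ (e + k + 2) ≤ a * c * s ^ (e + k + 2) := mul_le_mul_of_nonpos_left (pow_le_pow_left₀ hs.le hst _) hac.le
  nlinarith

/-- ★★ **THE LATE COUNT** (pure incoherent company, `K = 3`, bottom coupling, ANY support `d 0 < d 1 < d 2`): if at `U₀ > 0` the unswitched rows
are few, `(d₂−d₁)·#{j : a_{j0}·f_j(U₀) > 0} ≤ (d₁−d₀)·m`, then `eulerNumerator d a 0` has at most `2m + 1` roots in `[U₀, ∞)` — whatever the ages
of the risers beyond `U₀`. [this file's theorem] -/
theorem euler_roots_late_le_of_fewPullers {m : ℕ} (d : Fin 3 → ℕ) (h01 : d 0 < d 1) (h12 : d 1 < d 2)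
    (a : Fin m → Fin 3 → ℝ) (hinc : ∀ j, a j 0 * a j 1 < 0 ∧ a j 0 * a j 2 < 0) {U₀ : ℝ} (hU : 0 < U₀)
    (hfew : ((d 2 : ℝ) - d 1)
      * ((Finset.univ.filter (fun j => 0 < a j 0 * (∑ l, C (a j l) * X ^ (d l) : ℝ[X]).eval U₀)).card : ℝ)
        ≤ ((d 1 : ℝ) - d 0) * m) :
    ((∑ j, (∑ l, C (a j l * ((d l : ℝ) - d 0)) * X ^ (d l)) * ∏ i ∈ Finset.univ.erase j, (∑ l, C (a i l) * X ^ (d l))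
        : ℝ[X]).roots.toFinset.filter (fun t => U₀ ≤ t)).card ≤ 2 * m + 1 := by
  classical
  rcases Nat.eq_zero_or_pos m with hm | hm
  · subst hm
    simp only [Finset.univ_eq_empty, Finset.sum_empty, roots_zero, Multiset.toFinset_zero, Finset.filter_empty,
      Finset.card_empty]
    exact Nat.zero_le _
  obtain ⟨e, he⟩ : ∃ e, d 1 = d 0 + e + 1 := ⟨d 1 - d 0 - 1, by omega⟩
  obtain ⟨k, hk⟩ : ∃ k, d 2 = d 0 + e + k + 2 := ⟨d 2 - d 1 - 1, by omega⟩
  have hp : ((d 1 : ℝ) - d 0) = (e + 1 : ℝ) := by rw [he]; push_cast; ring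
  have hqp : ((d 2 : ℝ) - d 1) = (k + 1 : ℝ) := by rw [hk, he]; push_cast; ring
  have hd2 : (0 : ℝ) ≤ (d 2 : ℝ) - d 1 := by
    have : (d 1 : ℝ) < d 2 := by exact_mod_cast h12
    linarith
  rw [eulerNumerator_eq d e k he hk a 0, sub_self, mul_zero, map_zero, zero_mul, sub_zero]
  set P : ℝ[X] := ∏ j, (C (a j 0) + C (a j 1) * X ^ (e + 1) + C (a j 2) * X ^ (e + k + 2)) with hPdef
  have hac' : ∀ j, a j 0 * a j 2 < 0 := fun j => (hinc j).2
  have hinc' : ∀ j, a j 0 * a j 1 < 0 ∧ a j 0 * a j 2 < 0 := hinc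
  have hP0 : P ≠ 0 := prod_trinomial_ne_zero (fun j => a j 0) (fun j => a j 1) (fun j => a j 2) e k hac'
  refine (card_roots_X_pow_mul_filter_le (m * d 0) (X * derivative P) (fun t => U₀ ≤ t) (fun t ht => (hU.trans_le ht).ne')).trans ?_
  have hZ : (P.roots.toFinset.filter (fun t => U₀ ≤ t)).card ≤ m := by
    refine le_trans (card_le_card fun t ht => ?_)
      (prod_trinomial_pos_roots_le (fun j => a j 0) (fun j => a j 1) (fun j => a j 2) e k hac')
    rw [mem_filter] at ht ⊢
    exact ⟨ht.1, hU.trans_le ht.2⟩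
  -- few pullers at `U₀` ⇒ few pullers at every `t ≥ U₀`
  have hfewt : ∀ t : ℝ, U₀ ≤ t → ((k : ℝ) + 1)
      * ((Finset.univ.filter (fun j => 0 < a j 0 * (a j 0 + a j 1 * t ^ (e + 1) + a j 2 * t ^ (e + k + 2)))).card : ℝ)
        ≤ ((e : ℝ) + 1) * m := by
    intro t hUt
    have hset0 : Finset.univ.filter (fun j => 0 < a j 0 * (∑ l, C (a j l) * X ^ (d l) : ℝ[X]).eval U₀)
        = Finset.univ.filter (fun j => 0 < a j 0 * (a j 0 + a j 1 * U₀ ^ (e + 1) + a j 2 * U₀ ^ (e + k + 2))) := by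
      refine Finset.filter_congr (fun j _ => ?_)
      rw [eval_row_eq_pow_mul d e k he hk (a j) U₀, mul_left_comm]
      exact ⟨fun h' => pos_of_mul_pos_right h' (pow_pos hU _).le, fun h' => mul_pos (pow_pos hU _) h'⟩
    have hsub : Finset.univ.filter (fun j => 0 < a j 0 * (a j 0 + a j 1 * t ^ (e + 1) + a j 2 * t ^ (e + k + 2)))
        ⊆ Finset.univ.filter (fun j => 0 < a j 0 * (a j 0 + a j 1 * U₀ ^ (e + 1) + a j 2 * U₀ ^ (e + k + 2))) := by
      intro j hj
      rw [mem_filter] at hj ⊢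
      exact ⟨hj.1, unswitched_of_le (a j 0) (a j 1) (a j 2) e k (hinc j).1 (hinc j).2 hU hUt hj.2⟩
    have hcard := Finset.card_le_card hsub
    have h := hfew
    rw [hp, hqp, hset0] at h
    have hcardR : (((Finset.univ.filter (fun j => 0 < a j 0 * (a j 0 + a j 1 * t ^ (e + 1) + a j 2 * t ^ (e + k + 2)))).card : ℝ))
        ≤ (Finset.univ.filter (fun j => 0 < a j 0 * (a j 0 + a j 1 * U₀ ^ (e + 1) + a j 2 * U₀ ^ (e + k + 2)))).card := by
      exact_mod_cast hcard
    have hk0 : (0 : ℝ) ≤ (k : ℝ) + 1 := by positivity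
    exact (mul_le_mul_of_nonneg_left hcardR hk0).trans h
  have h := roots_filter_le_of_windowLaw P (X * derivative P) hP0 (fun t => U₀ ≤ t)
    (fun z₁ _ t h₁ _ h₂ _ => h₁.trans h₂) m hZ (fun w₁ w₂ hw₁ _ hw hfree h1 h2 => ?_)
  · exact h.trans (by omega)
  · have hfree' : ∀ t ∈ Set.Icc w₁ w₂, ∀ j, a j 0 + a j 1 * t ^ (e + 1) + a j 2 * t ^ (e + k + 2) ≠ 0 := by
      intro t ht j hj
      apply hfree t ht
      rw [hPdef, eval_prod_trinomial, Finset.prod_eq_zero_iff]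
      exact ⟨j, mem_univ _, hj⟩
    exact X_mul_derivative_no_two_zeros_of_fewPullers hm (fun j => a j 0) (fun j => a j 1) (fun j => a j 2) e k
      (hU.trans_le hw₁) hw hinc' hfree' (fun t ht => hfewt t (hw₁.trans ht.1)) h1 h2

end ProductPlusOne

end Summit.ValiantsHypothesis.ValiantsHypothesis.Theorems.LacunarySymmetroidMatrixDescartes
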